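import Summits.CriticalPhenomena.Ising3DConformalLimit.Theses.PositivityBegetsConformality

/-!
# CriticalPhenomena / Ising3DConformalLimit — route PositivityBegetsConformality, assembly

Settles item `stmt-CriticalPhenomena-4677` (rank 1, assembly of route
`route-CriticalPhenomena-PositivityBegetsConformality`):

`InversionPositiveLimit → MoebiusOfInversionPositive → ExistsScaleCovariantLimit →
IsingEuclidUpgradeR4NonGaussian → Ising3DConformalLimit`.

Pure logic over the summit's structure predicates
(`Literature/Probability/LatticeModels/ConformalCovariance.lean`,
`Literature/Probability/LatticeModels/ScalingLimit3D.lean`): take `ρ, Δ, S` from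
(E₀) `ExistsScaleCovariantLimit` (normalised off `NonCoincident`, non-degenerate, translation
invariant, scale covariant with `Δ > 0`); (IP) `InversionPositiveLimit` gives inversion
positivity of `S` with weight `Δ` (the radial Osterwalder–Schrader Gram matrices are
`Matrix.PosSemidef`); (M) `MoebiusOfInversionPositive` turns this into `IsMoebiusCovariant Δ S`;
(NG) `IsingEuclidUpgradeR4NonGaussian` gives `HasNontrivialU4 S`; these are exactly the clauses
of `Ising3DConformalLimit = Literature.Probability.LatticeModels.CritIsing3DConformalLimit`.
No named facts are used and no definitions are introduced; the theorem is unconditional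
bookkeeping (it coincides with the route's deciding theorem `closes`).
-/

namespace Summit.CriticalPhenomena.Ising3DConformalLimit.Theorems

open Summit.CriticalPhenomena.Ising3DConformalLimit.Theses.PositivityBegetsConformality
open Literature.Probability.LatticeModels

/-- Settles `stmt-CriticalPhenomena-4677` (exact signature): the assembly
`InversionPositiveLimit → MoebiusOfInversionPositive → ExistsScaleCovariantLimit →
IsingEuclidUpgradeR4NonGaussian → Ising3DConformalLimit` of route PositivityBegetsConformality.
Proof: `ρ, Δ, S` from (E₀); (IP) ⇒ the radial OS Gram matrices of `S` with weight `Δ` are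
positive semi-definite; (M) ⇒ `IsMoebiusCovariant Δ S`; (NG) ⇒ `HasNontrivialU4 S`; pack the
witness `⟨ρ, Δ, S, ρ > 0, Δ > 0, limit, non-degeneracy, Möbius, U₄⟩` into
`CritIsing3DConformalLimit` (Di Francesco–Mathieu–Sénéchal 1997 §4.3.1 for the Möbius
generators; Mack 1975 for positivity ⇒ covariance, used only through (M)). [folklore] -/
theorem positivityBegetsConformality_assembly_proof :
    Summit.CriticalPhenomena.Ising3DConformalLimit.Theses.PositivityBegetsConformality.Assembly := by
  unfold Assembly
  intro hIP hM hE hNG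
  obtain ⟨ρ, Δ, S, hρ, hΔ, hlim, hnorm, hnd, htr, hsc⟩ := hE
  have hpos := hIP ρ Δ S hρ hlim hnorm hnd htr hsc
  have hMoeb : IsMoebiusCovariant Δ S := hM ρ Δ S hρ hlim hnorm hnd htr hsc hpos
  have hU4 : HasNontrivialU4 S := hNG ρ S hρ hlim hnd
  exact ⟨ρ, Δ, S, hρ, hΔ, hlim, hnd, hMoeb, hU4⟩

end Summit.CriticalPhenomena.Ising3DConformalLimit.Theorems
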